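import Summits.Langlands.Langlands.Theorems.IrreducibilityBySelfDualityReciprocityUpToIrreducibilityRankOneUnramified
import Summits.Langlands.Langlands.Theorems.IrreducibilityBySelfDualityReciprocityUpToIrreducibilityCorrespondsConj
import Summits.Langlands.Langlands.Theorems.IrreducibilityBySelfDualityIrreducibleOffSectorTransfer
import Literature.NumberTheory.GaloisRepresentations.WeakAbelianDirectSummandProofs
import Summits.Langlands.Langlands.Theorems.IrreducibilityBySelfDualityReciprocityUpToIrreducibilityRankOneCuspidalModel
import Summits.Langlands.Langlands.Theorems.IrreducibilityBySelfDualityReciprocityUpToIrreducibilityRankOneSatake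
import HarnessLib

/-!
# Line `Sketch` for the crux `ReciprocityUpToIrreducibility` (item stmt-Langlands-14328), continuation c4:
# rank one, every reciprocity datum — both directions of the correspondence on the
# finite-order, everywhere-unramified sector

Support file (closes nothing; continuation lead c4, prover-line-stmt-Langlands-14328-c4-0).

With local–global compatibility at the good places (`…RankOneUnramified`, p125744) the two directions
of the summit's `GlobalLanglandsCorrespondenceGLn 1` become provable — for EVERY `Rec : ReciprocityData K`
— on the sector where no place is bad:

* `automorphicToGalois_glOne_of_unramified` — direction (A) at the datum `π_θ = ℂ·(θ ∘ det)/⊥` of a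
  finite-order Hecke character `θ` unramified at every finite place: an irreducible, geometric
  `ρ` (the `ℓ`-adic avatar of `θ`, `HeckeCharacter.exists_lAdic_of_isFiniteOrder`) with
  `Corresponds Rec ι π_θ ρ`, unique up to conjugacy among all corresponding `ρ'` (Chebotarev,
  `isConjugate_of_satakeFrobCompatibleAt`).
* `galoisToAutomorphic_glOne_of_isOpen_ker` — direction (B) at every `ρ : Γ_K → GL₁(ℚ̄_ℓ)` with open
  kernel unramified at every finite place: a cuspidal L-algebraic `π` with `Corresponds Rec ι π ρ`
  (Artin reciprocity, `FramedGaloisRep.exists_heckeCharacter_of_isOpen_ker`).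

Both under `FontaineDatumExists` (the `v ∣ ℓ` clause), using the two registered wave-3 stubs (Satake
parameter of the model at every unramified place of `θ`, `stub_rankOne_hasSatakeParamAt_of_isUnramifiedAt`,
p126080; cuspidal L-algebraic model of a finite-order `θ`, `stub_rankOne_cuspidalModel_of_isFiniteOrder`,
p126035).  No definitions; std axioms.
-/

noncomputable section

set_option linter.dupNamespace false -- project-wide option (lakefile weak.linter.dupNamespace); `Summit.Langlands.Langlands` is the mandated namespace

open scoped MatrixGroups Matrix NumberField Classical Polynomial
open Filter IsDedekindDomain Field Polynomial
open Literature.NumberTheory.Automorphic Literature.NumberTheory.GaloisRepresentations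
open Literature.NumberTheory.PAdicHodge
open Summit.Langlands
open Summit.Langlands.Langlands.Theorems.IrreducibleOffSector

namespace Summit.Langlands.Langlands.Theorems.ReciprocityUpToIrreducibility

variable {K : Type} [Field K] [NumberField K] {ℓ : ℕ} [Fact ℓ.Prime]

/-- A `GL₁` datum with `W = ℂ·(θ ∘ det)` is acted on by `GL₁(𝔸_K)` through `θ ∘ det` (modulo any
`W'`). [folklore] -/
theorem smul_char_of_detTwist_model {hcpt : isCompact_glFiniteIntegralLevel 1 K}
    {π : AutomorphicRepData (AutomorphyDatum.gl 1 K hcpt)} {θ : HeckeCharacter K}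
    (hW : π.W = Submodule.span ℂ {fun g : (AdelicGroupData.gl 1 K).Adelic => (detTwist 1 θ g : ℂ)}) :
    ∀ (g : (AdelicGroupData.gl 1 K).Adelic), ∀ φ ∈ π.W,
      rightTranslation (AdelicGroupData.gl 1 K) g φ -
        ((θ (Matrix.GeneralLinearGroup.det g) : ℂˣ) : ℂ) • φ ∈ π.W' := by
  intro g φ hφ
  rw [hW, Submodule.mem_span_singleton] at hφ
  obtain ⟨c, rfl⟩ := hφ
  rw [map_smul, rightTranslation_detTwist_glOne, detTwist_apply, smul_comm, sub_self]
  exact π.W'.zero_mem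

/-- **Satake–Frobenius compatibility of the `ℓ`-adic avatar at EVERY unramified place of `θ`**
(wave-3 Satake stub, p126080): for the model `π_θ` and `ρ` with
`char ρ(Frob_v^{arith}) = X - ι⁻¹(θ(ϖ_v))⁻¹` at a place `v` where `θ` and `ρ` are unramified.
[cite: BuzzardGeeLMS2014, Conj. 3.2.1 and Rem. 3.2.5] -/
theorem satakeFrobCompatibleAt_model_of_hasFrobCharpolyAt
    {hcpt : isCompact_glFiniteIntegralLevel 1 K} (ι : PadicAlgCl ℓ ≃+* ℂ)
    {π : AutomorphicRepData (AutomorphyDatum.gl 1 K hcpt)} {θ : HeckeCharacter K}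
    (hW : π.W = Submodule.span ℂ {fun g : (AdelicGroupData.gl 1 K).Adelic => (detTwist 1 θ g : ℂ)})
    (hW' : π.W' = ⊥) (ρ : FramedGaloisRep K (PadicAlgCl ℓ) 1) {v : HeightOneSpectrum (𝓞 K)}
    (hur : θ.IsUnramifiedAt v) (hρ : ρ.IsUnramifiedAt v)
    (hfrob : ρ.HasFrobCharpolyAt v (X - C (ι.symm (θ.valueAtUniformizer v)⁻¹))) :
    SatakeFrobCompatibleAt ι π ρ v := by
  refine ⟨{((θ (localUnits v (HeckeCharacter.uniformizer K v)) : ℂˣ) : ℂ)},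
    stub_rankOne_hasSatakeParamAt_of_isUnramifiedAt K hcpt θ π hW hW' v hur _
      (HeckeCharacter.valued_uniformizer (K := K) (v := v)), hρ, ?_⟩
  rw [arithFrobPolyOfSatake_one, Multiset.map_singleton, Multiset.prod_singleton]
  have : ((θ (localUnits v (HeckeCharacter.uniformizer K v)) : ℂˣ) : ℂ) = θ.valueAtUniformizer v := rfl
  rw [this]
  exact hfrob

/-- **Direction (A) in rank one on the everywhere-unramified finite-order sector, for EVERY
reciprocity datum** (under `FontaineDatumExists`).  For a
finite-order Hecke character `θ` unramified at every finite place and its model `π_θ = ℂ·(θ ∘ det)/⊥`: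
there is `ρ : Γ_K → GL₁(ℚ̄_ℓ)` irreducible, geometric (unramified everywhere), with
`Corresponds Rec ι π_θ ρ`, and every `ρ'` corresponding to `π_θ` is conjugate to `ρ` — the body of
`AutomorphicToGalois 1 Rec hcpt` at `π_θ`.  `ρ` is the `ℓ`-adic avatar of `θ` (global class field
theory, `HeckeCharacter.exists_lAdic_of_isFiniteOrder`); local–global compatibility at every place by
`rankOne_localGlobalCompatibleAt_of_satakeFrobCompatibleAt`; uniqueness by Chebotarev
(`isConjugate_of_satakeFrobCompatibleAt`). [cite: BuzzardGeeLMS2014, Conj. 3.2.1–3.2.2 (n = 1)]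
[cite: CasselsFrohlichANT1967, Ch. VII §5.1 Main Theorem] [cite: DeligneSerreASENS1974, Lemme 3.2] -/
theorem automorphicToGalois_glOne_of_unramified
    (hF : FontaineDatumExists) {hcpt : isCompact_glFiniteIntegralLevel 1 K}
    (Rec : ReciprocityData K) (ι : PadicAlgCl ℓ ≃+* ℂ)
    {π : AutomorphicRepData (AutomorphyDatum.gl 1 K hcpt)} {θ : HeckeCharacter K}
    (hW : π.W = Submodule.span ℂ {fun g : (AdelicGroupData.gl 1 K).Adelic => (detTwist 1 θ g : ℂ)})
    (hW' : π.W' = ⊥) (hfin : θ.IsFiniteOrder) (hunr : ∀ v : HeightOneSpectrum (𝓞 K), θ.IsUnramifiedAt v) :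
    ∃ ρ : FramedGaloisRep K (PadicAlgCl ℓ) 1,
      ρ.toGaloisRep.IsIrreducible ∧ IsGeometricFramed Rec ρ ∧ Corresponds Rec ι π ρ ∧
        ∀ ρ' : FramedGaloisRep K (PadicAlgCl ℓ) 1, Corresponds Rec ι π ρ' → IsConjugate ρ ρ' := by
  obtain ⟨ρ, hram, hfrob⟩ := θ.exists_lAdic_of_isFiniteOrder hfin ι
  have hρunr : ∀ v, ρ.IsUnramifiedAt v := fun v => (hram v).2 (hunr v)
  have hsat : ∀ v, SatakeFrobCompatibleAt ι π ρ v := fun v =>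
    satakeFrobCompatibleAt_model_of_hasFrobCharpolyAt ι hW hW' ρ (hunr v) (hρunr v)
      (hfrob v (hunr v))
  have hcorr : Corresponds Rec ι π ρ :=
    ⟨Filter.Eventually.of_forall hsat, fun v =>
      rankOne_localGlobalCompatibleAt_of_satakeFrobCompatibleAt hF Rec ι π θ
        (smul_char_of_detTwist_model hW) ρ (hunr v) (hsat v)⟩
  refine ⟨ρ, isIrreducible_of_rank_one ρ, isGeometricFramed_of_forall_isUnramifiedAt Rec ρ hρunr,
    hcorr, fun ρ' h' => ?_⟩
  exact isConjugate_of_satakeFrobCompatibleAt π ι (isIrreducible_of_rank_one ρ) hcorr.1 h'.1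

/-- **Direction (B) in rank one on the everywhere-unramified open-kernel sector, for EVERY
reciprocity datum** (under `FontaineDatumExists`).  Every
`ρ : Γ_K → GL₁(ℚ̄_ℓ)` with open kernel and unramified at every finite place corresponds, at every
finite place, to a cuspidal L-algebraic `π` of `GL₁(𝔸_K)` — the body of `GaloisToAutomorphic 1 Rec hcpt`
at `ρ`.  `ρ` comes from a finite-order Hecke character `χ` (Artin reciprocity,
`FramedGaloisRep.exists_heckeCharacter_of_isOpen_ker`: `χ` unramified with
`char ρ(Frob_v^{arith}) = X - ι⁻¹(χ(ϖ_v))⁻¹` at every place where `ρ` is unramified, i.e. everywhere);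
`π = ℂ·(χ ∘ det)/⊥`; local–global compatibility at every place by
`rankOne_localGlobalCompatibleAt_of_satakeFrobCompatibleAt`. [cite: FontaineMazurGeometric1995, Conj. 1 (n = 1)]
[cite: CasselsFrohlichANT1967, Ch. VII §5.1 Main Theorem] [cite: BuzzardGeeLMS2014, Conj. 3.2.2 (n = 1)] -/
theorem galoisToAutomorphic_glOne_of_isOpen_ker
    (hF : FontaineDatumExists) (hcpt : isCompact_glFiniteIntegralLevel 1 K)
    (Rec : ReciprocityData K) (ι : PadicAlgCl ℓ ≃+* ℂ) (ρ : FramedGaloisRep K (PadicAlgCl ℓ) 1)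
    (hker : IsOpen (ρ.toMonoidHom.ker : Set (absoluteGaloisGroup K)))
    (hunr : ∀ v : HeightOneSpectrum (𝓞 K), ρ.IsUnramifiedAt v) :
    ∃ π : CuspidalAutomorphicRepData 1 K hcpt, π.1.IsLAlgebraic ∧ Corresponds Rec ι π.1 ρ := by
  obtain ⟨χ, -, hfin, hχ⟩ := ρ.exists_heckeCharacter_of_isOpen_ker hker ι
  obtain ⟨π, hW, hW', hL⟩ := stub_rankOne_cuspidalModel_of_isFiniteOrder K hcpt χ hfin
  have hsat : ∀ v, SatakeFrobCompatibleAt ι π.1 ρ v := fun v =>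
    satakeFrobCompatibleAt_model_of_hasFrobCharpolyAt ι hW hW' ρ (hχ v (hunr v)).1 (hunr v)
      (hχ v (hunr v)).2
  exact ⟨π, hL, Filter.Eventually.of_forall hsat, fun v =>
    rankOne_localGlobalCompatibleAt_of_satakeFrobCompatibleAt hF Rec ι π.1 χ
      (smul_char_of_detTwist_model hW) ρ (hχ v (hunr v)).1 (hsat v)⟩

/-- **Registered stub `stub_automorphicToGalois_glOne_of_unramified` of line `Sketch` (crux
stmt-Langlands-14328), closed form of `automorphicToGalois_glOne_of_unramified`.**
[cite: BuzzardGeeLMS2014, Conj. 3.2.1–3.2.2 (n = 1)] [cite: CasselsFrohlichANT1967, Ch. VII §5.1 Main Theorem] -/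
theorem stub_automorphicToGalois_glOne_of_unramified :
    FontaineDatumExists → ∀ (K : Type) [Field K] [NumberField K] (ℓ : ℕ) [Fact ℓ.Prime]
      (hcpt : isCompact_glFiniteIntegralLevel 1 K) (Rec : ReciprocityData K) (ι : PadicAlgCl ℓ ≃+* ℂ)
      (π : AutomorphicRepData (AutomorphyDatum.gl 1 K hcpt)) (θ : HeckeCharacter K),
      π.W = Submodule.span ℂ {fun g : (AdelicGroupData.gl 1 K).Adelic => (detTwist 1 θ g : ℂ)} →
      π.W' = ⊥ → θ.IsFiniteOrder → (∀ v : HeightOneSpectrum (𝓞 K), θ.IsUnramifiedAt v) →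
      ∃ ρ : FramedGaloisRep K (PadicAlgCl ℓ) 1,
        ρ.toGaloisRep.IsIrreducible ∧ IsGeometricFramed Rec ρ ∧ Corresponds Rec ι π ρ ∧
          ∀ ρ' : FramedGaloisRep K (PadicAlgCl ℓ) 1, Corresponds Rec ι π ρ' → IsConjugate ρ ρ' :=
  fun hF _ _ _ _ _ _ Rec ι _ _ hW hW' hfin hunr =>
    automorphicToGalois_glOne_of_unramified hF Rec ι hW hW' hfin hunr

/-- **Registered stub `stub_galoisToAutomorphic_glOne_of_isOpen_ker` of line `Sketch` (crux
stmt-Langlands-14328), closed form of `galoisToAutomorphic_glOne_of_isOpen_ker`.**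
[cite: FontaineMazurGeometric1995, Conj. 1 (n = 1)] [cite: CasselsFrohlichANT1967, Ch. VII §5.1 Main Theorem] -/
theorem stub_galoisToAutomorphic_glOne_of_isOpen_ker :
    FontaineDatumExists → ∀ (K : Type) [Field K] [NumberField K] (ℓ : ℕ) [Fact ℓ.Prime]
      (hcpt : isCompact_glFiniteIntegralLevel 1 K) (Rec : ReciprocityData K) (ι : PadicAlgCl ℓ ≃+* ℂ)
      (ρ : FramedGaloisRep K (PadicAlgCl ℓ) 1),
      IsOpen (ρ.toMonoidHom.ker : Set (absoluteGaloisGroup K)) →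
      (∀ v : HeightOneSpectrum (𝓞 K), ρ.IsUnramifiedAt v) →
      ∃ π : CuspidalAutomorphicRepData 1 K hcpt, π.1.IsLAlgebraic ∧ Corresponds Rec ι π.1 ρ :=
  fun hF _ _ _ _ _ hcpt Rec ι ρ hker hunr =>
    galoisToAutomorphic_glOne_of_isOpen_ker hF hcpt Rec ι ρ hker hunr

end Summit.Langlands.Langlands.Theorems.ReciprocityUpToIrreducibility

end
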